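import Literature.AlgebraicGeometry.HodgeTheory.PicardLefschetzSymmetricA3
import Summits.HodgeConjecture.HodgeConjecture.Theorems.SignSymmetricPowersNodalFormsTools

/-!
# K1-B LINK-F witnesses (route `SignSymmetricPowers`, item stmt-HodgeConjecture-19716) — the symmetric `A₃`
# form at `e₄`, I: jets

Helper file for the registered stub `stub_signConfluenceLinkF` (K1-B line `andre-zariski` v12b, LINK-F; memo
`K1B-LINKF-PLAN-g23.md` §2): an explicit ι-even quinary form of every even degree `d = 2n + 4` carrying a
SYMMETRIC `A₃` point at `e₄ = [0:0:0:0:1]` with kernel direction `x₀` (the Π/pair confluence datum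
`IsSymmetricA3Datum f₁ g₀ g₂ 4 0 γ` of `HodgeTheory/PicardLefschetzSymmetricA3`), SPLIT variant of the memo's
witness so that the singular point is unique by pure algebra plus one modulus comparison (part II). This part:
the gradient in closed form and the jets at `e₄` (gradient `0`, Hessian of rank `3` killing `x₀`, no cubic term
`x₀² xᵢ`, quartic term `∂₀⁴ f₁(e₄) ≠ 0`), for ARBITRARY coefficients `c₀ c₁ c₃` (except `∂₀⁴`, which needs
`c₀ ≠ -1` when `n = 0`). Landed `--supports stmt-HodgeConjecture-19716` as a helper. Sorry-free; axioms standard.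

`f₁ = x₄^{2n+2}(x₁² + x₂x₃) + x₄^{2n} x₀⁴ + c₀ x₀^{2n+4} + c₁ x₁^{2n+4} + x₂^{2n+4} + c₃ x₃^{2n+4}`.
-/

set_option linter.dupNamespace false

noncomputable section

namespace Summit.HodgeConjecture.HodgeConjecture.Theorems.SignSymmetricPowersSymmetricA3PlaneJet

open MvPolynomial Literature.AlgebraicGeometry.Motives Literature.AlgebraicGeometry.HodgeTheory
open Summit.HodgeConjecture.HodgeConjecture.Theorems.SignSymmetricPowersNodalFormsTools

/-- **Rank `3` of a `5 × 5` matrix** with two vanishing columns (`M ⬝ diag u = M`, `u` vanishing exactly at two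
indices) and a two-sided multiple `A M B = diag w` with `w` vanishing exactly at two indices. -/
theorem rank_eq_three {M A B : Matrix (Fin 5) (Fin 5) ℂ} {u w : Fin 5 → ℂ} (k₁ k₂ : Fin 5) (hk : k₁ ≠ k₂)
    (hu : ∀ i, u i = 0 ↔ i = k₁ ∨ i = k₂) (hMu : M * Matrix.diagonal u = M)
    (hw : A * M * B = Matrix.diagonal w) (hwk : ∀ i, w i = 0 ↔ i = k₁ ∨ i = k₂) : M.rank = 3 := by
  classical
  have hcard : ∀ v : Fin 5 → ℂ, (∀ i, v i = 0 ↔ i = k₁ ∨ i = k₂) → Fintype.card {i // v i ≠ 0} = 3 := by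
    intro v hv
    rw [Fintype.card_subtype]
    have hset : Finset.univ.filter (fun i : Fin 5 ↦ v i ≠ 0) = (Finset.univ.erase k₁).erase k₂ := by
      ext i
      simp only [Finset.mem_filter, Finset.mem_univ, true_and, Finset.mem_erase, ne_eq, hv, not_or, and_true]
      tauto
    rw [hset, Finset.card_erase_of_mem (by simp [Finset.mem_erase, hk.symm]),
      Finset.card_erase_of_mem (Finset.mem_univ _), Finset.card_univ, Fintype.card_fin]
  apply le_antisymm
  · calc M.rank = (M * Matrix.diagonal u).rank := by rw [hMu]
      _ ≤ (Matrix.diagonal u).rank := Matrix.rank_mul_le_right _ _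
      _ = 3 := by rw [Matrix.rank_diagonal, hcard u hu]
  · calc 3 = (Matrix.diagonal w).rank := by rw [Matrix.rank_diagonal, hcard w hwk]
      _ = (A * M * B).rank := by rw [hw]
      _ ≤ (A * M).rank := Matrix.rank_mul_le_left _ _
      _ ≤ M.rank := Matrix.rank_mul_le_right _ _

/-- The gradient of the `A₃`-witness (closed form, arbitrary `c₀ c₁ c₃`). -/
theorem pderiv_a3PlaneForm (n : ℕ) (c₀ c₁ c₃ : ℂ) :
    let f : MvPolynomial (Fin 5) ℂ := X 4 ^ (2 * n + 2) * (X 1 ^ 2 + X 2 * X 3) + X 4 ^ (2 * n) * X 0 ^ 4 +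
      C c₀ * X 0 ^ (2 * n + 4) + C c₁ * X 1 ^ (2 * n + 4) + X 2 ^ (2 * n + 4) + C c₃ * X 3 ^ (2 * n + 4)
    pderiv 0 f = C 4 * X 4 ^ (2 * n) * X 0 ^ 3 + C (c₀ * (2 * (n : ℂ) + 4)) * X 0 ^ (2 * n + 3) ∧
    pderiv 1 f = C 2 * X 4 ^ (2 * n + 2) * X 1 + C (c₁ * (2 * (n : ℂ) + 4)) * X 1 ^ (2 * n + 3) ∧
    pderiv 2 f = X 4 ^ (2 * n + 2) * X 3 + C (2 * (n : ℂ) + 4) * X 2 ^ (2 * n + 3) ∧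
    pderiv 3 f = X 4 ^ (2 * n + 2) * X 2 + C (c₃ * (2 * (n : ℂ) + 4)) * X 3 ^ (2 * n + 3) ∧
    pderiv 4 f = C (2 * (n : ℂ) + 2) * X 4 ^ (2 * n + 1) * (X 1 ^ 2 + X 2 * X 3) +
      C (2 * (n : ℂ)) * X 4 ^ (2 * n - 1) * X 0 ^ 4 := by
  intro f
  refine ⟨?_, ?_, ?_, ?_, ?_⟩ <;>
  · simp +decide only [f, map_add, Derivation.leibniz, Derivation.leibniz_pow, pderiv_X, pderiv_C,
      Pi.single_apply, smul_eq_mul, mul_zero, add_zero, Nat.add_succ_sub_one, if_true, if_false,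
      nsmul_eq_mul, Nat.cast_add, Nat.cast_mul, Nat.cast_ofNat, mul_one]
    simp only [map_add, map_mul, map_natCast, map_ofNat]
    ring

/-- The gradient of the `A₃`-witness as a vector of closed forms. -/
theorem pderiv_a3PlaneForm_eq (n : ℕ) (c₀ c₁ c₃ : ℂ) (j : Fin 5) :
    pderiv j (X 4 ^ (2 * n + 2) * (X 1 ^ 2 + X 2 * X 3) + X 4 ^ (2 * n) * X 0 ^ 4 +
      C c₀ * X 0 ^ (2 * n + 4) + C c₁ * X 1 ^ (2 * n + 4) + X 2 ^ (2 * n + 4) + C c₃ * X 3 ^ (2 * n + 4) :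
        MvPolynomial (Fin 5) ℂ) =
      (![C 4 * X 4 ^ (2 * n) * X 0 ^ 3 + C (c₀ * (2 * (n : ℂ) + 4)) * X 0 ^ (2 * n + 3),
          C 2 * X 4 ^ (2 * n + 2) * X 1 + C (c₁ * (2 * (n : ℂ) + 4)) * X 1 ^ (2 * n + 3),
          X 4 ^ (2 * n + 2) * X 3 + C (2 * (n : ℂ) + 4) * X 2 ^ (2 * n + 3),
          X 4 ^ (2 * n + 2) * X 2 + C (c₃ * (2 * (n : ℂ) + 4)) * X 3 ^ (2 * n + 3),
          C (2 * (n : ℂ) + 2) * X 4 ^ (2 * n + 1) * (X 1 ^ 2 + X 2 * X 3) +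
            C (2 * (n : ℂ)) * X 4 ^ (2 * n - 1) * X 0 ^ 4] : Fin 5 → MvPolynomial (Fin 5) ℂ) j := by
  obtain ⟨h0, h1, h2, h3, h4⟩ := pderiv_a3PlaneForm n c₀ c₁ c₃
  fin_cases j
  exacts [h0, h1, h2, h3, h4]

/-- `∂₀∂₀ f₁` in closed form. -/
theorem pderiv_zero_zero_a3PlaneForm (n : ℕ) (c₀ c₁ c₃ : ℂ) :
    pderiv 0 (pderiv 0 (X 4 ^ (2 * n + 2) * (X 1 ^ 2 + X 2 * X 3) + X 4 ^ (2 * n) * X 0 ^ 4 +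
      C c₀ * X 0 ^ (2 * n + 4) + C c₁ * X 1 ^ (2 * n + 4) + X 2 ^ (2 * n + 4) + C c₃ * X 3 ^ (2 * n + 4) :
        MvPolynomial (Fin 5) ℂ)) =
      C 12 * X 4 ^ (2 * n) * X 0 ^ 2 + C (c₀ * (2 * (n : ℂ) + 4) * (2 * (n : ℂ) + 3)) * X 0 ^ (2 * n + 2) := by
  rw [pderiv_a3PlaneForm_eq n c₀ c₁ c₃ 0]
  simp +decide only [Matrix.cons_val_zero, map_add, Derivation.leibniz, Derivation.leibniz_pow, pderiv_X,
    pderiv_C, Pi.single_apply, smul_eq_mul, mul_zero, add_zero, Nat.add_succ_sub_one, if_true, if_false,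
    nsmul_eq_mul, Nat.cast_add, Nat.cast_mul, Nat.cast_ofNat, mul_one]
  simp only [map_add, map_mul, map_natCast, map_ofNat]
  ring

set_option maxHeartbeats 400000 in
/-- **The jets of the `A₃`-witness at `e₄`**: gradient `0`; Hessian of rank `3` with zero `x₀`-column; no cubic
terms `x₀² xᵢ`; quartic term `∂₀⁴ f₁(e₄) ≠ 0` (for `c₀ (2n+4) = 4`). -/
theorem jets_a3PlaneForm (n : ℕ) (c₀ c₁ c₃ : ℂ) (hc₀ : c₀ * (2 * n + 4) = 4) :
    let f : MvPolynomial (Fin 5) ℂ := X 4 ^ (2 * n + 2) * (X 1 ^ 2 + X 2 * X 3) + X 4 ^ (2 * n) * X 0 ^ 4 +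
      C c₀ * X 0 ^ (2 * n + 4) + C c₁ * X 1 ^ (2 * n + 4) + X 2 ^ (2 * n + 4) + C c₃ * X 3 ^ (2 * n + 4)
    (∀ i, eval (Pi.single 4 1) (pderiv i f) = 0) ∧
    (Matrix.of fun i i' : Fin 5 => eval (Pi.single 4 1) (pderiv i (pderiv i' f))).rank = 3 ∧
    (∀ i, eval (Pi.single 4 1) (pderiv i (pderiv 0 f)) = 0) ∧
    (∀ i, eval (Pi.single 4 1) (pderiv i (pderiv 0 (pderiv 0 f))) = 0) ∧
    eval (Pi.single 4 1) (pderiv 0 (pderiv 0 (pderiv 0 (pderiv 0 f)))) ≠ 0 := by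
  intro f
  have hcol := pderiv_a3PlaneForm_eq n c₀ c₁ c₃
  have h00 := pderiv_zero_zero_a3PlaneForm n c₀ c₁ c₃
  have hM : (Matrix.of fun i i' : Fin 5 => eval (Pi.single 4 1 : Fin 5 → ℂ) (pderiv i (pderiv i' f))) =
      !![0, 0, 0, 0, 0; 0, 2, 0, 0, 0; 0, 0, 0, 1, 0; 0, 0, 1, 0, 0; 0, 0, 0, 0, 0] := by
    ext i i'
    rw [Matrix.of_apply, hcol i']
    fin_cases i <;> fin_cases i' <;> simp [Derivation.leibniz, Derivation.leibniz_pow, pderiv_X]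
  refine ⟨fun i => ?_, ?_, fun i => ?_, fun i => ?_, ?_⟩
  · rw [hcol i]
    fin_cases i <;> simp
  · rw [hM]
    refine rank_eq_three (u := ![0, 1, 1, 1, 0]) (w := ![0, 2, 1, 1, 0]) (A := 1)
      (B := !![0, 0, 0, 0, 0; 0, 1, 0, 0, 0; 0, 0, 0, 1, 0; 0, 0, 1, 0, 0; 0, 0, 0, 0, 0]) 0 4 (by decide)
      ?_ ?_ ?_ ?_
    · intro i; fin_cases i <;> simp
    · ext i j
      fin_cases i <;> fin_cases j <;> simp [Matrix.mul_apply, Matrix.diagonal]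
    · ext i j
      fin_cases i <;> fin_cases j <;> simp [Matrix.mul_apply, Fin.sum_univ_five]
    · intro i; fin_cases i <;> simp
  · have h := congr_fun (congr_fun hM i) 0
    rw [Matrix.of_apply] at h
    rw [h]
    fin_cases i <;> simp
  · rw [h00]
    fin_cases i <;> simp [Derivation.leibniz, Derivation.leibniz_pow, pderiv_X]
  · rw [h00]
    rcases Nat.eq_zero_or_pos n with rfl | hn
    · have hc : c₀ = 1 := by
        have : c₀ * 4 = 4 := by simpa using hc₀
        linear_combination this / 4
      subst hc
      simp [Derivation.leibniz, Derivation.leibniz_pow, pderiv_X]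
      norm_num
    · simp [Derivation.leibniz, Derivation.leibniz_pow, pderiv_X, zero_pow (by omega : 2 * n ≠ 0)]

end Summit.HodgeConjecture.HodgeConjecture.Theorems.SignSymmetricPowersSymmetricA3PlaneJet

end
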